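import Mathlib
import Summits.Ventures.GridStability.Models.ClassicalSwing

/-!
# GridStability/Models/KronReduction — network reduction to the internal machine nodes («Kron reduction») as a kernel statement

Cell `gridfusion` (LADDER-GRIDFUSION rung G3 «model register» → G1/G2), seat gridfusion-model-1
(model row 1: «classical NETWORK-REDUCED multimachine swing model … reduced admittance»),
`plan/PARTITION.md` §0 row `Models/`. THREE COLUMNS: everything here is the MODELLED column —
an exact piece of linear algebra about the constant-impedance network model; no certificate, no
sentence about any grid.

## What is typed, AS PRINTED

[cite: SauerPai1998, §7.9.3 «Internal-node model», eqs (7.205)–(7.212)]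
[galaxy:panama:353827995779076 chunks p0130–p0131, read on the page] and the same elimination for
the terminal-bus model [cite: SauerPai1998, §7.5, eqs (7.89)–(7.91) + Example 7.4]
[chunks p0115–p0116]:

* loads converted to constant admittances `ȳ_Li = −(P_Li − jQ_Li)/V_i²` and added to the
  diagonal of the augmented bus admittance matrix (7.205)–(7.206);
* the augmented network equations in block form (7.207)
  `[Ī_A; 0] = [[Ȳ_A, Ȳ_B], [Ȳ_C, Ȳ_D]] [Ē_A; V̄_B]` — internal machine nodes `A` carry the
  injected generator currents `Ī_A`, «the n network buses can be eliminated, since there is no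
  current injection at these buses»;
* the reduction (7.208) `Ī_A = (Ȳ_A − Ȳ_B Ȳ_D⁻¹ Ȳ_C) Ē_A = Ȳ_int Ē_A` (= (7.91)
  `Ȳ_red = Ȳ₁ − Ȳ₂ Ȳ₄⁻¹ Ȳ₃` for the terminal-bus partition (7.90));
* the internal-node electrical power (7.209)–(7.212)
  `P_ei = Re[Ē_i Ī_i^*] = Σ_j E_iE_j (G_ij cos δ_ij + B_ij sin δ_ij)`, `Ȳ_ij = G_ij + jB_ij`,
  `Ē_i = E_i∠δ_i` — which is EXACTLY model-1's `ClassicalSwing.Pe` (`ClassicalSwing.Pe_eq_sum`,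
  p459650).

## What is proved (kernel facts; the reduction step of the benchmark data pipeline is exact)

* `Kron.reduce` — the Schur complement `Ȳ_A − Ȳ_B Ȳ_D⁻¹ Ȳ_C` of a block-indexed matrix
  (index types `α ⊕ β`: `α` = retained nodes, `β` = eliminated nodes; any field, used over `ℂ`);
* `Kron.network_equations_iff` — with `Ȳ_D` invertible, the eliminated-bus equations
  «zero injection at every `β`-bus» hold IFF the eliminated voltages are
  `V̄_B = −Ȳ_D⁻¹ Ȳ_C Ē_A` (`Kron.eliminatedVoltage`): the algebraic part of the constant-impedance
  network model is uniquely and globally solvable — the well-posedness that MODEL-VALIDITY MV-4(c)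
  asks a DAE certificate to supply is, for constant-impedance loads, just `det Ȳ_D ≠ 0`;
* `Kron.current_eq_reduce_mulVec` — for EVERY solution of the full network equations with zero
  injection at the eliminated buses, the retained-node currents are `Ȳ_int Ē_A` (7.208);
* `Kron.reduce_isSymm` — reciprocity survives the reduction (`Ȳ` symmetric ⇒ `Ȳ_int` symmetric),
  the hypothesis used by every energy-function file of the cell;
* `Kron.reduce_units_smul`, `Kron.reduce_map` — homogeneity under a unit (base change of
  admittances, multiplication by `j`) and commutation with field morphisms (`ℚ → ℝ → ℂ`: the
  exact-rational reductions of the data pipeline ARE the complex ones);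
  `Kron.reduce_of_purely_reactive` / `re_reduce_of_purely_reactive` — a purely reactive
  augmented network `Ȳ = j·B` reduces to `j·(reduced B)`: ALL reduced conductances vanish exactly,
  so the transfer conductances that the lossless energy function drops (MODEL-VALIDITY MV-2L)
  enter only through the real parts of the load admittances (7.205), never through the
  elimination;
* `Kron.re_power_eq_Pe` — (7.210)–(7.212): the real power `Re[Ē_i (Ȳ_int Ē)_i^*]` out of
  internal node `i` equals `ClassicalSwing.Pe` of the record whose `G`, `B` are the real and
  imaginary parts of `Ȳ_int`; assembled in `Kron.pe_eq_re_power_of_network_solution`: along any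
  state of the full constant-impedance network consistent with the algebraic equations, the power
  each machine delivers INTO THE FULL NETWORK is the reduced model's `P_ei(δ)`.

Hence the sentence used throughout the cell's MODELLED columns — «network Kron-reduced to the
internal nodes (constant-impedance loads)» (WSCC9 p464217, NE39 p467599, KUNDUR2A p466090; model-2
`StructurePreservingDAE` docstring «constant-impedance loads + Kron reduction ⇒ model-1's
ClassicalSwing (MV-2)»; director RULING 18 (b) label «Kron-reduced constant-impedance loads») —
names an EXACT algebraic step: the only modelling content is «loads are constant impedances»
(+ the classical machine), never the elimination itself. model-4's exact-rational reduction
scripts (bench/data/*/build_*.py) compute `Kron.reduce` entrywise over `ℚ(i)`.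

MODELLED: absent effects = those of `ClassicalSwing` (MV-1/MV-2) + constant-impedance load
representation (MV-5*, `Models/Loads.lean`); the reduction adds none.
-/

noncomputable section

open Matrix Complex Finset

namespace Summit.Ventures.GridStability.Models.Kron

variable {α β K : Type*} [Fintype α] [Fintype β] [DecidableEq β] [Field K]

/-- **Kron reduction** of a block-partitioned admittance matrix to the retained node set `α`
(eliminating `β`): the Schur complement `Ȳ_A − Ȳ_B Ȳ_D⁻¹ Ȳ_C` of [cite: SauerPai1998, (7.208)]
(= `Ȳ₁ − Ȳ₂Ȳ₄⁻¹Ȳ₃` of (7.91)). MODELLED: exact linear algebra; meaningful as a network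
equivalent when `Ȳ_D` is invertible (hypothesis of the theorems below). -/
def reduce (Y : Matrix (α ⊕ β) (α ⊕ β) K) : Matrix α α K :=
  Y.toBlocks₁₁ - Y.toBlocks₁₂ * (Y.toBlocks₂₂)⁻¹ * Y.toBlocks₂₁

/-- The voltages of the eliminated buses forced by the zero-injection equations:
`V̄_B = −Ȳ_D⁻¹ Ȳ_C Ē_A` (solving the lower block row of (7.207)). -/
def eliminatedVoltage (Y : Matrix (α ⊕ β) (α ⊕ β) K) (E : α → K) : β → K :=
  -(((Y.toBlocks₂₂)⁻¹ * Y.toBlocks₂₁) *ᵥ E)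

omit [DecidableEq β] in
/-- Lower block row of the network equations: the current injected at an eliminated bus `b` in
the network state `(Ē_A, V̄_B)` is `(Ȳ_C Ē_A + Ȳ_D V̄_B)_b`. -/
theorem mulVec_inr (Y : Matrix (α ⊕ β) (α ⊕ β) K) (E : α → K) (V : β → K) (b : β) :
    (Y *ᵥ Sum.elim E V) (Sum.inr b) = (Y.toBlocks₂₁ *ᵥ E + Y.toBlocks₂₂ *ᵥ V) b := by
  conv_lhs => rw [← fromBlocks_toBlocks Y, fromBlocks_mulVec]
  rfl

omit [DecidableEq β] in
/-- Upper block row of the network equations: the current injected at a retained node `a` is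
`(Ȳ_A Ē_A + Ȳ_B V̄_B)_a`. -/
theorem mulVec_inl (Y : Matrix (α ⊕ β) (α ⊕ β) K) (E : α → K) (V : β → K) (a : α) :
    (Y *ᵥ Sum.elim E V) (Sum.inl a) = (Y.toBlocks₁₁ *ᵥ E + Y.toBlocks₁₂ *ᵥ V) a := by
  conv_lhs => rw [← fromBlocks_toBlocks Y, fromBlocks_mulVec]
  rfl

/-- **Solvability of the algebraic network equations (constant-impedance loads).** If the
eliminated block `Ȳ_D` is invertible, then «no current injection at the eliminated buses»
[cite: SauerPai1998, (7.207)] holds IFF the eliminated voltages equal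
`Kron.eliminatedVoltage Y Ē_A = −Ȳ_D⁻¹ Ȳ_C Ē_A`: existence AND uniqueness of the algebraic
solution, globally in the machine state. (MODEL-VALIDITY MV-4(c): for constant-impedance loads
the DAE's algebraic part is this linear solve.) -/
theorem network_equations_iff (Y : Matrix (α ⊕ β) (α ⊕ β) K) (hD : IsUnit Y.toBlocks₂₂.det)
    (E : α → K) (V : β → K) :
    (∀ b, (Y *ᵥ Sum.elim E V) (Sum.inr b) = 0) ↔ V = eliminatedVoltage Y E := by
  simp only [mulVec_inr]
  constructor
  · intro h
    have hfun : Y.toBlocks₂₁ *ᵥ E + Y.toBlocks₂₂ *ᵥ V = 0 := funext h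
    have hV : Y.toBlocks₂₂ *ᵥ V = -(Y.toBlocks₂₁ *ᵥ E) := eq_neg_of_add_eq_zero_right hfun
    have := congrArg (fun w => (Y.toBlocks₂₂)⁻¹ *ᵥ w) hV
    simp only [mulVec_mulVec, nonsing_inv_mul _ hD, one_mulVec, mulVec_neg] at this
    rw [this, eliminatedVoltage]
  · rintro rfl
    intro b
    have h : Y.toBlocks₂₂ *ᵥ eliminatedVoltage Y E = -(Y.toBlocks₂₁ *ᵥ E) := by
      rw [eliminatedVoltage, mulVec_neg, mulVec_mulVec, ← Matrix.mul_assoc,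
        mul_nonsing_inv _ hD, Matrix.one_mul]
    rw [h]
    simp

/-- **Kron's elimination (7.208).** For EVERY network state `(Ē_A, V̄_B)` satisfying the
zero-injection equations at the eliminated buses (`Ȳ_D` invertible), the currents injected at the
retained nodes are `Ȳ_int Ē_A` with `Ȳ_int = Kron.reduce Y`. [cite: SauerPai1998, (7.208), (7.91)] -/
theorem current_eq_reduce_mulVec (Y : Matrix (α ⊕ β) (α ⊕ β) K) (hD : IsUnit Y.toBlocks₂₂.det)
    {E : α → K} {V : β → K} (h0 : ∀ b, (Y *ᵥ Sum.elim E V) (Sum.inr b) = 0) (a : α) :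
    (Y *ᵥ Sum.elim E V) (Sum.inl a) = (reduce Y *ᵥ E) a := by
  rw [(network_equations_iff Y hD E V).1 h0, mulVec_inl, eliminatedVoltage, reduce, sub_mulVec,
    mulVec_neg, mulVec_mulVec, Matrix.mul_assoc]
  simp [sub_eq_add_neg]

/-- The reduced network fed with `Ē_A` and the eliminated voltages set to
`Kron.eliminatedVoltage` IS a solution of the full network equations with zero injection at the
eliminated buses (existence direction, pointwise form). -/
theorem network_equations_eliminatedVoltage (Y : Matrix (α ⊕ β) (α ⊕ β) K)
    (hD : IsUnit Y.toBlocks₂₂.det) (E : α → K) (b : β) :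
    (Y *ᵥ Sum.elim E (eliminatedVoltage Y E)) (Sum.inr b) = 0 :=
  (network_equations_iff Y hD E _).2 rfl b

omit [Fintype α] in
/-- **Reciprocity survives Kron reduction**: a symmetric (reciprocal-network) admittance matrix
has a symmetric reduction — the hypothesis `B_ij = B_ji`, `G_ij = G_ji` of every energy-function
statement in the cell is inherited from the full network. -/
theorem reduce_isSymm {Y : Matrix (α ⊕ β) (α ⊕ β) K} (hY : Y.IsSymm) : (reduce Y).IsSymm := by
  have h11 : Y.toBlocks₁₁ᵀ = Y.toBlocks₁₁ := by
    ext i j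
    simp only [transpose_apply, toBlocks₁₁, of_apply]
    exact hY.apply (Sum.inl i) (Sum.inl j)
  have h22 : Y.toBlocks₂₂ᵀ = Y.toBlocks₂₂ := by
    ext i j
    simp only [transpose_apply, toBlocks₂₂, of_apply]
    exact hY.apply (Sum.inr i) (Sum.inr j)
  have h12 : Y.toBlocks₁₂ᵀ = Y.toBlocks₂₁ := by
    ext i j
    simp only [transpose_apply, toBlocks₁₂, toBlocks₂₁, of_apply]
    exact hY.apply (Sum.inr i) (Sum.inl j)
  have h21 : Y.toBlocks₂₁ᵀ = Y.toBlocks₁₂ := by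
    ext i j
    simp only [transpose_apply, toBlocks₁₂, toBlocks₂₁, of_apply]
    exact hY.apply (Sum.inl i) (Sum.inr j)
  unfold Matrix.IsSymm reduce
  rw [transpose_sub, transpose_mul, transpose_mul, transpose_nonsing_inv, h11, h22, h12, h21,
    Matrix.mul_assoc]

/-! ## Scaling, base change, and the purely reactive («lossless») case -/

omit [Fintype α] in
/-- Kron reduction is homogeneous of degree one under scaling by a unit (per-unit base change of
admittances; multiplication by `j`). -/
theorem reduce_units_smul (c : Kˣ) (Y : Matrix (α ⊕ β) (α ⊕ β) K) (hD : IsUnit Y.toBlocks₂₂.det) :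
    reduce (c • Y) = c • reduce Y := by
  have h12 : (c • Y).toBlocks₁₂ = c • Y.toBlocks₁₂ := rfl
  have h21 : (c • Y).toBlocks₂₁ = c • Y.toBlocks₂₁ := rfl
  have h11 : (c • Y).toBlocks₁₁ = c • Y.toBlocks₁₁ := rfl
  have h22 : (c • Y).toBlocks₂₂ = c • Y.toBlocks₂₂ := rfl
  rw [reduce, reduce, h11, h12, h21, h22, Matrix.inv_smul' (A := Y.toBlocks₂₂) c hD, smul_sub]
  congr 1
  simp only [Matrix.smul_mul, Matrix.mul_smul, smul_smul, inv_mul_cancel, mul_one]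

omit [Fintype α] in
/-- The inverse of a base-changed matrix is the base change of the inverse (ring morphism of
fields, invertible block). -/
theorem map_nonsing_inv {L : Type*} [Field L] (f : K →+* L) (A : Matrix β β K)
    (hA : IsUnit A.det) : (A.map f)⁻¹ = A⁻¹.map f := by
  have hA' : IsUnit (A.map f).det := by
    have h := hA.map f
    rw [RingHom.map_det, RingHom.mapMatrix_apply] at h
    exact h
  refine inv_eq_left_inv ?_
  rw [← Matrix.map_mul, nonsing_inv_mul _ hA, Matrix.map_one _ (map_zero f) (map_one f)]

omit [Fintype α] in
/-- Kron reduction commutes with base change along a field morphism (e.g. `ℝ → ℂ`, `ℚ → ℝ`: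
model-4's exact rational reductions ARE the real/complex ones). -/
theorem reduce_map {L : Type*} [Field L] (f : K →+* L) (Y : Matrix (α ⊕ β) (α ⊕ β) K)
    (hD : IsUnit Y.toBlocks₂₂.det) : reduce (Y.map f) = (reduce Y).map f := by
  have h11 : (Y.map f).toBlocks₁₁ = Y.toBlocks₁₁.map f := rfl
  have h12 : (Y.map f).toBlocks₁₂ = Y.toBlocks₁₂.map f := rfl
  have h21 : (Y.map f).toBlocks₂₁ = Y.toBlocks₂₁.map f := rfl
  have h22 : (Y.map f).toBlocks₂₂ = Y.toBlocks₂₂.map f := rfl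
  rw [reduce, reduce, h11, h12, h21, h22, map_nonsing_inv f _ hD, ← Matrix.map_mul,
    ← Matrix.map_mul, Matrix.map_sub _ (map_sub f)]

omit [Fintype α] in
/-- **Purely reactive augmented network ⇒ zero transfer conductances, exactly.** If every entry
of the augmented admittance matrix is purely imaginary, `Ȳ = j·B` with `B` real (lossless lines,
machine reactances, and purely REACTIVE shunt loads) and `B_D` is invertible, then the reduced
matrix is `j·(Kron-reduced B)`: all reduced conductances `G_ij` vanish. Contrapositive reading
for MODEL-VALIDITY MV-2L: the transfer conductances the lossless energy function drops come from
the REAL parts of the load admittances (7.205) (active-power loads), not from the elimination. -/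
theorem reduce_of_purely_reactive (B : Matrix (α ⊕ β) (α ⊕ β) ℝ)
    (hD : IsUnit B.toBlocks₂₂.det) :
    reduce ((Units.mk0 I I_ne_zero) • B.map (algebraMap ℝ ℂ)) =
      (Units.mk0 I I_ne_zero) • (reduce B).map (algebraMap ℝ ℂ) := by
  have hD' : IsUnit (B.map (algebraMap ℝ ℂ)).toBlocks₂₂.det := by
    have h := hD.map (algebraMap ℝ ℂ)
    rw [RingHom.map_det, RingHom.mapMatrix_apply] at h
    exact h
  rw [reduce_units_smul _ _ hD', reduce_map _ _ hD]

omit [Fintype α] in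
/-- In the purely reactive case the reduced CONDUCTANCE matrix vanishes entrywise. -/
theorem re_reduce_of_purely_reactive (B : Matrix (α ⊕ β) (α ⊕ β) ℝ)
    (hD : IsUnit B.toBlocks₂₂.det) (a a' : α) :
    (reduce ((Units.mk0 I I_ne_zero) • B.map (algebraMap ℝ ℂ)) a a').re = 0 := by
  rw [reduce_of_purely_reactive B hD]
  simp [Units.smul_def]

/-! ## Internal-node power: (7.209)–(7.212) = `ClassicalSwing.Pe` -/

/-- The internal EMF phasors `Ē_i = E_i∠δ_i = E_i e^{jδ_i}` [cite: SauerPai1998, after (7.208)]. -/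
def phasor {n : ℕ} (E δ : Fin n → ℝ) (i : Fin n) : ℂ := (E i : ℂ) * exp ((δ i : ℂ) * I)

/-- Real part of one term of (7.210): `Re[E_i e^{jδ_i} (G − jB) E_j e^{−jδ_j}]
= E_iE_j (G cos δ_ij + B sin δ_ij)`. -/
theorem re_phasor_mul_conj (Ei Ej δi δj : ℝ) (y : ℂ) :
    (((Ei : ℂ) * exp ((δi : ℂ) * I)) * (starRingEnd ℂ) (y * ((Ej : ℂ) * exp ((δj : ℂ) * I)))).re
      = Ei * Ej * (y.re * Real.cos (δi - δj) + y.im * Real.sin (δi - δj)) := by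
  have hi : exp ((δi : ℂ) * I) = ⟨Real.cos δi, Real.sin δi⟩ := by
    apply Complex.ext <;> simp [exp_ofReal_mul_I_re, exp_ofReal_mul_I_im]
  have hj : exp ((δj : ℂ) * I) = ⟨Real.cos δj, Real.sin δj⟩ := by
    apply Complex.ext <;> simp [exp_ofReal_mul_I_re, exp_ofReal_mul_I_im]
  rw [hi, hj, Real.cos_sub, Real.sin_sub]
  simp only [map_mul, mul_re, mul_im, ofReal_re, ofReal_im, conj_re, conj_im, Complex.conj_ofReal]
  ring

/-- **(7.210)–(7.212) in the kernel.** For any complex `m × m` matrix `Ȳ_int` whose real and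
imaginary parts are the record's `G` and `B`, the real electrical power out of internal node `i`,
`P_ei = Re[Ē_i Ī_i^*]` with `Ī = Ȳ_int Ē` (7.209) and `Ē = E∠δ`, equals model-1's
`ClassicalSwing.Pe p δ i` [cite: SauerPai1998, (7.212)] (via `ClassicalSwing.Pe_eq_sum`). -/
theorem re_power_eq_Pe {n : ℕ} (p : ClassicalSwing n) (Yint : Matrix (Fin n) (Fin n) ℂ)
    (hG : ∀ i j, (Yint i j).re = p.G i j) (hB : ∀ i j, (Yint i j).im = p.B i j)
    (δ : Fin n → ℝ) (i : Fin n) :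
    (phasor p.E δ i * (starRingEnd ℂ) ((Yint *ᵥ phasor p.E δ) i)).re = p.Pe δ i := by
  rw [p.Pe_eq_sum δ i, mulVec, dotProduct, map_sum, Finset.mul_sum, Complex.re_sum]
  refine Finset.sum_congr rfl fun j _ => ?_
  rw [phasor, phasor, re_phasor_mul_conj, hG, hB]

/-- **The classical record OF a reduced network.** Machine data `(M, D, P, E)` together with an
augmented constant-impedance admittance matrix `Y` on (internal nodes `Fin n`) ⊕ (network buses
`β`) give the internal-node classical model whose `G + jB` is `Kron.reduce Y`
[cite: SauerPai1998, §7.9.3]. MODELLED: MV-1/MV-2 + constant-impedance loads (MV-5*). -/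
def classicalOfNetwork {n : ℕ} (M D P E : Fin n → ℝ) (Y : Matrix (Fin n ⊕ β) (Fin n ⊕ β) ℂ) :
    ClassicalSwing n where
  M := M
  D := D
  P := P
  E := E
  G := fun i j => (reduce Y i j).re
  B := fun i j => (reduce Y i j).im

/-- **Fidelity of the reduction step (exact).** Along ANY state of the full constant-impedance
network — internal EMFs `E∠δ` at the machine nodes, arbitrary bus voltages `V̄_B` — that satisfies
the algebraic network equations (zero injection at every network bus; `Ȳ_D` invertible), the real
power machine `i` delivers into the FULL network, `Re[Ē_i Ī_i^*]` with `Ī = (Y [Ē; V̄_B])_A`,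
equals `ClassicalSwing.Pe` of the Kron-reduced record at the angles `δ`. So the swing equations
written with the reduced `P_ei(δ)` are the swing equations of the structure-preserving
constant-impedance model, state by state. [cite: SauerPai1998, (7.207)–(7.212)] -/
theorem pe_eq_re_power_of_network_solution {n : ℕ} (M D P E : Fin n → ℝ)
    (Y : Matrix (Fin n ⊕ β) (Fin n ⊕ β) ℂ) (hD : IsUnit Y.toBlocks₂₂.det) (δ : Fin n → ℝ)
    {V : β → ℂ} (h0 : ∀ b, (Y *ᵥ Sum.elim (phasor E δ) V) (Sum.inr b) = 0) (i : Fin n) :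
    (classicalOfNetwork M D P E Y).Pe δ i =
      (phasor E δ i * (starRingEnd ℂ) ((Y *ᵥ Sum.elim (phasor E δ) V) (Sum.inl i))).re := by
  rw [current_eq_reduce_mulVec Y hD h0 i]
  exact (re_power_eq_Pe (classicalOfNetwork M D P E Y) (reduce Y) (fun _ _ => rfl)
    (fun _ _ => rfl) δ i).symm

end Summit.Ventures.GridStability.Models.Kron

end
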